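import Summits.BirchSwinnertonDyer.BirchSwinnertonDyer.Theorems.ManinLocalTwoThreeShimuraQuotientRational
import Summits.BirchSwinnertonDyer.BirchSwinnertonDyer.Theorems.ManinLocalTwoThreeCDivisionIntegralCDT
import HarnessLib

/-!
# E-an-152d `IndexFourForcesFullRationalTwoTorsion` IS A THEOREM modulo two PRINTED facts (F★ ∧ CES), CDT-free;
# hence C2 `ManinOddAtFour` ⟸ CDT Theorem 1 ∧ F★ ∧ CES ∧ E-an-152e (the Frey-type habitat ALONE)
(route `ManinLocalTwoThree`, crux C2 `ManinOddAtFour` stmt-BirchSwinnertonDyer-22967; cell bsd-f2-manin, prover p2 gen 21;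
`--supports stmt-BirchSwinnertonDyer-22967`; ref1 §R212(b)'s route, on LEAD p1 g10's `…ShimuraQuotientRational` §3)

THE ROW (an g45, `CDivisionNeron.IndexFourForcesFullRationalTwoTorsion`, `…CDivisionNeronPeriodsConsumers`): for a lattice-optimal
`X₀(N)`-datum `D₀` of a globally minimal `W₀` at `4 ∣ N` in the index-`4` configuration `Λ₁(f) = 2Λ₀(f)`, the curve `W₀` has THREE
distinct rational `2`-torsion abscissae (`Greenberg1999.HasRationalTwoTorsionX`).

PROOF (no Unbounded Denominators, no `Σ(N)`): CES (`exists_optimal_gamma1ParametrizationData`, Stevens 1989 / Conrad–Edixhoven–Stein 2003: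
the class carries an OPTIMAL `X₁(N)`-datum `D₁` on a globally minimal `W₁`) and `Gamma1ParametrizationData.f_eq_of_isIsogenous` put us in
LEAD's §3 of `…ShimuraQuotientRational`: index `4` forces `Λ_{W₀} = Λ_{W₁}` (`lattice_eq_of_index_four`, via `c₀ = ±2c₁`) and every
half-period `z` of `Λ_{W₀}` is `c₁·w` with `w ∈ Λ₀(f)`, so by F★ (`optimalGamma1Parametrization_cusp_rational`, CES 2003 §6.1.2/§6.2: the optimal
`X₁(N)`-parametrisation maps the cusps over `∞` to RATIONAL points) `℘_{Λ_{W₀}}(z) ∈ ℚ`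
(`exists_ratCast_eq_weierstrassP_halfPeriod_of_index_four`).  NEW HERE: (§1) for ANY model (no `a₁ = a₃ = 0`), a half-period `z` with
`℘(z) = X ∈ ℚ` gives the rational `2`-torsion point `(X − b₂/12, −(a₁x + a₃)/2)` of `W₀` — the uniformisation's own point at `z`
(`uniformize_spec`, `℘′(z) = 0`), pulled back along `ℚ ↪ ℂ` (`Affine.map_nonsingular`); (§2) the three half-periods `ω₁/2, ω₂/2, (ω₁+ω₂)/2`
have pairwise distinct `℘`-values (`weierstrassP_eq_weierstrassP_iff`: `℘(u) = ℘(v)` off the lattice forces `u ± v ∈ Λ`; inlined — the tree's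
`Literature.Geometry.Kaehler.ComplexTorus.weierstrassP_halfPeriods_ne'` states it but lives outside this build cone); (§3) the row BY NAME; (§4) the compositions: E-an-152c ⟸ F★ ∧ CES ∧
E-an-152e, **C2 ⟸ CDT Theorem 1 ∧ F★ ∧ CES ∧ E-an-152e** (`CDivisionInt.maninOddAtFour_of_CDTInt_freyHabitat`), and `ManinConstantOne ⟸
PrintedSemistableManinFacts ∧ CDT Theorem 1 ∧ F★ ∧ CES ∧ E-an-152e`.

HONEST FRAMING.  CONDITIONAL on the statement-only printed facts F★, CES (and, for C2, CDT Theorem 1); E-an-152e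
`CDivisionNeron.ShimuraIndexNeFourAtFourFreyHabitat` (index-`4` exclusion for optimal Frey-type curves `y² = x(x − A)(x + B)` at `N = 2^a·m`, `m` odd
squarefree) is OPEN — it is now the WHOLE residual of C2.  C2, Manin's conjecture and BSD are NOT proved here.  No definitions, no sorry.
[cite: ConradEdixhovenStein2003, §6.1.2 and §6.2 (F★); §6.1, Lemma 6.1.6 (CES)] [cite: Stevens1989, §2] [cite: GreenbergLNM1716, Prop. 5.14]
[cite: CalegariDimitrovTang2025, Thm. 1.0.1] [cite: SilvermanAEC2009, Prop. VI.3.6]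
-/

set_option autoImplicit false
-- lint-debt: the directory name repeats the summit name (sibling precedent `ManinLocalTwoThreeShimuraQuotientRational.lean`)
set_option linter.dupNamespace false

noncomputable section

open scoped PeriodPair
open WeierstrassCurve Literature.NumberTheory.EllipticCurves Literature.NumberTheory.EllipticCurves.ModularForms
open Literature.NumberTheory.EllipticCurves.Greenberg1999
open Literature.NumberTheory.Automorphic

namespace Summit.BirchSwinnertonDyer.BirchSwinnertonDyer.Theorems.ManinLocalTwoThree.IndexFourTwoTorsion

/-! ## §1 A half-period with rational `℘`-value is a rational `2`-torsion abscissa (any model) -/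

/-- **Half-period with rational `℘`-value ⟹ rational `2`-torsion point.**  For an `X₀(N)`-datum `D` of `W` (any model over `ℚ`), a point
`z ∉ Λ_W` with `2z ∈ Λ_W` and `℘_{Λ_W}(z) = X ∈ ℚ`: `x := X − b₂/12` is a rational `2`-torsion abscissa of `W` in Greenberg's sense, with
`y = −(a₁x + a₃)/2` — the uniformisation's point at `z` is `(℘(z) − b₂/12, (℘′(z) − a₁x − a₃)/2)` (`uniformize_spec`) and `℘′(z) = 0`.
[cite: SilvermanAEC2009, Prop. VI.3.6] [cite: GreenbergLNM1716, Prop. 5.14] -/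
theorem hasRationalTwoTorsionX_of_ratCast_eq_weierstrassP {W : WeierstrassCurve ℚ} {N : ℕ} [NeZero N]
    (D : ModularParametrizationData W N) {z : ℂ} (hz : z ∉ D.L.lattice) (h2z : 2 * z ∈ D.L.lattice) {X : ℚ}
    (hX : (X : ℂ) = ℘[D.L] z) : HasRationalTwoTorsionX W (X - W.b₂ / 12) := by
  obtain ⟨h, -⟩ := D.uniformize_spec z hz
  have h0 : ℘'[D.L] z = 0 := D.L.derivWeierstrassP_eq_zero_of_two_mul_mem h2z
  set x : ℚ := X - W.b₂ / 12 with hx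
  set y : ℚ := -(W.a₁ * x + W.a₃) / 2 with hy
  have hb₂ : (W.baseChange ℂ).b₂ = (W.b₂ : ℂ) := by simp [WeierstrassCurve.baseChange, WeierstrassCurve.map_b₂]
  have ha₁ : (W.baseChange ℂ).a₁ = (W.a₁ : ℂ) := by simp [WeierstrassCurve.baseChange]
  have ha₃ : (W.baseChange ℂ).a₃ = (W.a₃ : ℂ) := by simp [WeierstrassCurve.baseChange]
  have hxC : (algebraMap ℚ ℂ) x = ℘[D.L] z - (W.baseChange ℂ).b₂ / 12 := by
    rw [hb₂]
    change ((x : ℚ) : ℂ) = _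
    rw [hx]; push_cast; rw [hX]
  have hyC : (algebraMap ℚ ℂ) y =
      (℘'[D.L] z - (W.baseChange ℂ).a₁ * (℘[D.L] z - (W.baseChange ℂ).b₂ / 12) - (W.baseChange ℂ).a₃) / 2 := by
    rw [← hxC, h0, ha₁, ha₃]
    change ((y : ℚ) : ℂ) = _
    change _ = (0 - (W.a₁ : ℂ) * ((x : ℚ) : ℂ) - (W.a₃ : ℂ)) / 2
    rw [hy]; push_cast; ring
  have hns : (W.toAffine.map (algebraMap ℚ ℂ)).Nonsingular ((algebraMap ℚ ℂ) x) ((algebraMap ℚ ℂ) y) := by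
    rw [hxC, hyC]; exact h
  exact ⟨y, ((W.toAffine.map_nonsingular (algebraMap ℚ ℂ).injective x y).mp hns).left, by rw [hy]; ring⟩

/-! ## §2 Half-periods: `(ω₁ + ω₂)/2 ∉ Λ`, and no half-integral combination lies in `Λ` -/

/-- `(ω₁ + ω₂)/2 ∉ Λ`. [folklore] -/
theorem half_sum_notMem_lattice (L : PeriodPair) : (L.ω₁ + L.ω₂) / 2 ∉ L.lattice := by
  intro h
  have h' : ((1 / 2 : ℚ) : ℂ) * L.ω₁ + ((1 / 2 : ℚ) : ℂ) * L.ω₂ ∈ L.lattice := by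
    convert h using 1; push_cast; ring
  exact absurd (PeriodPair.mul_ω₁_add_mul_ω₂_mem_lattice.mp h').1 (by norm_num)

/-- A combination `α ω₁ + β ω₂` with a non-integral rational coefficient is not a lattice point. [folklore] -/
theorem ratCast_mul_add_notMem_lattice (L : PeriodPair) {α β : ℚ} (hαβ : α.den ≠ 1 ∨ β.den ≠ 1) :
    (α : ℂ) * L.ω₁ + (β : ℂ) * L.ω₂ ∉ L.lattice := by
  intro hmem
  obtain ⟨hα, hβ⟩ := PeriodPair.mul_ω₁_add_mul_ω₂_mem_lattice.mp hmem
  rcases hαβ with h | h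
  · exact h hα
  · exact h hβ

/-! ## §3 E-an-152d BY NAME, modulo F★ ∧ CES (CDT-free) -/

/-- **Index `4` ⟹ full rational `2`-torsion of `W₀`, for the optimal pair `(D₁, D₀)`** (F★-conditional, CDT-free): with an optimal `X₁(N)`-datum
`D₁` of a globally minimal `W₁` sharing the newform of the lattice-optimal `X₀(N)`-datum `D₀` of `W₀`, the index-`4` configuration yields three
pairwise distinct rational `2`-torsion abscissae of `W₀`. [cite: ConradEdixhovenStein2003, §6.1.2 and §6.2] [cite: Stevens1989, §2] -/
theorem exists_three_rationalTwoTorsionX_of_index_four (hF : optimalGamma1Parametrization_cusp_rational)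
    {W₁ W₀ : WeierstrassCurve ℚ} [W₁.IsElliptic] [W₁.IsGloballyMinimal] [W₀.IsElliptic] [W₀.IsGloballyMinimal] {N : ℕ} [NeZero N]
    (D₁ : Gamma1ParametrizationData W₁ N) (D₀ : ModularParametrizationData W₀ N) (h₁ : D₁.IsOptimal)
    (h₀ : ∀ z ∈ D₀.L.lattice, ∃ w ∈ periodLattice D₀.f, z = D₀.c * w) (hf : D₁.f = D₀.f)
    (hidx : ∀ z : ℂ, z ∈ periodLatticeGamma1 D₁.f ↔ ∃ w ∈ periodLattice D₀.f, z = 2 * w) :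
    ∃ x₁ x₂ x₃ : ℚ, x₁ ≠ x₂ ∧ x₁ ≠ x₃ ∧ x₂ ≠ x₃ ∧
      HasRationalTwoTorsionX W₀ x₁ ∧ HasRationalTwoTorsionX W₀ x₂ ∧ HasRationalTwoTorsionX W₀ x₃ := by
  set L := D₀.L with hL
  have hz₁ : L.ω₁ / 2 ∉ L.lattice := L.ω₁_div_two_notMem_lattice
  have hz₂ : L.ω₂ / 2 ∉ L.lattice := L.ω₂_div_two_notMem_lattice
  have hz₃ : (L.ω₁ + L.ω₂) / 2 ∉ L.lattice := half_sum_notMem_lattice L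
  have h2z₁ : 2 * (L.ω₁ / 2) ∈ L.lattice := by rw [mul_div_cancel₀ _ (two_ne_zero' ℂ)]; exact L.ω₁_mem_lattice
  have h2z₂ : 2 * (L.ω₂ / 2) ∈ L.lattice := by rw [mul_div_cancel₀ _ (two_ne_zero' ℂ)]; exact L.ω₂_mem_lattice
  have h2z₃ : 2 * ((L.ω₁ + L.ω₂) / 2) ∈ L.lattice := by
    rw [mul_div_cancel₀ _ (two_ne_zero' ℂ)]; exact add_mem L.ω₁_mem_lattice L.ω₂_mem_lattice
  obtain ⟨X₁, hX₁⟩ := exists_ratCast_eq_weierstrassP_halfPeriod_of_index_four hF D₁ D₀ h₁ h₀ hf hidx hz₁ h2z₁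
  obtain ⟨X₂, hX₂⟩ := exists_ratCast_eq_weierstrassP_halfPeriod_of_index_four hF D₁ D₀ h₁ h₀ hf hidx hz₂ h2z₂
  obtain ⟨X₃, hX₃⟩ := exists_ratCast_eq_weierstrassP_halfPeriod_of_index_four hF D₁ D₀ h₁ h₀ hf hidx hz₃ h2z₃
  -- the three `℘`-values are pairwise distinct: `℘(u) = ℘(v)` off the lattice forces `u ± v ∈ Λ`, and each `u ± v` has a coefficient `±1/2`
  have h12 : ℘[L] (L.ω₁ / 2) ≠ ℘[L] (L.ω₂ / 2) := fun h ↦ by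
    rcases (L.weierstrassP_eq_weierstrassP_iff hz₁ hz₂).mp h with h | h
    · exact ratCast_mul_add_notMem_lattice L (α := 1 / 2) (β := 1 / 2) (Or.inl (by norm_num)) (by convert h using 1; push_cast; ring)
    · exact ratCast_mul_add_notMem_lattice L (α := 1 / 2) (β := -(1 / 2)) (Or.inl (by norm_num)) (by convert h using 1; push_cast; ring)
  have h13 : ℘[L] (L.ω₁ / 2) ≠ ℘[L] ((L.ω₁ + L.ω₂) / 2) := fun h ↦ by
    rcases (L.weierstrassP_eq_weierstrassP_iff hz₁ hz₃).mp h with h | h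
    · exact ratCast_mul_add_notMem_lattice L (α := 1) (β := 1 / 2) (Or.inr (by norm_num)) (by convert h using 1; push_cast; ring)
    · exact ratCast_mul_add_notMem_lattice L (α := 0) (β := -(1 / 2)) (Or.inr (by norm_num)) (by convert h using 1; push_cast; ring)
  have h23 : ℘[L] (L.ω₂ / 2) ≠ ℘[L] ((L.ω₁ + L.ω₂) / 2) := fun h ↦ by
    rcases (L.weierstrassP_eq_weierstrassP_iff hz₂ hz₃).mp h with h | h
    · exact ratCast_mul_add_notMem_lattice L (α := 1 / 2) (β := 1) (Or.inl (by norm_num)) (by convert h using 1; push_cast; ring)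
    · exact ratCast_mul_add_notMem_lattice L (α := -(1 / 2)) (β := 0) (Or.inl (by norm_num)) (by convert h using 1; push_cast; ring)
  refine ⟨X₁ - W₀.b₂ / 12, X₂ - W₀.b₂ / 12, X₃ - W₀.b₂ / 12, ?_, ?_, ?_,
    hasRationalTwoTorsionX_of_ratCast_eq_weierstrassP D₀ hz₁ h2z₁ hX₁,
    hasRationalTwoTorsionX_of_ratCast_eq_weierstrassP D₀ hz₂ h2z₂ hX₂,
    hasRationalTwoTorsionX_of_ratCast_eq_weierstrassP D₀ hz₃ h2z₃ hX₃⟩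
  · intro h
    exact h12 (by rw [← hX₁, ← hX₂, sub_left_injective h])
  · intro h
    exact h13 (by rw [← hX₁, ← hX₃, sub_left_injective h])
  · intro h
    exact h23 (by rw [← hX₂, ← hX₃, sub_left_injective h])

/-- **E-an-152d `CDivisionNeron.IndexFourForcesFullRationalTwoTorsion` HOLDS modulo F★ ∧ CES — CDT-free.**  The optimal `X₁(N)`-datum comes from
CES, the common newform from `Gamma1ParametrizationData.f_eq_of_isIsogenous`; then §3.  CONDITIONAL on the two printed, statement-only facts
`optimalGamma1Parametrization_cusp_rational` (F★) and `exists_optimal_gamma1ParametrizationData` (CES); nothing about Manin's conjecture or BSD is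
proved by this. [cite: ConradEdixhovenStein2003, §6.1.2, §6.2 and Lemma 6.1.6] [cite: Stevens1989, §2] -/
theorem indexFourForcesFullRationalTwoTorsion_of_cuspRational_CES (hF : optimalGamma1Parametrization_cusp_rational)
    (hCES : exists_optimal_gamma1ParametrizationData) : CDivisionNeron.IndexFourForcesFullRationalTwoTorsion := by
  intro W₀ _ _ N _ D₀ hopt _h4 hidx
  obtain ⟨W₁, _, _, D₁, hiso, h₁⟩ := hCES W₀ D₀ hopt
  have hf : D₁.f = D₀.f := D₁.f_eq_of_isIsogenous D₀ hiso
  have hidx' : ∀ z : ℂ, z ∈ periodLatticeGamma1 D₁.f ↔ ∃ w ∈ periodLattice D₀.f, z = 2 * w := by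
    rw [hf]; exact hidx
  exact exists_three_rationalTwoTorsionX_of_index_four hF D₁ D₀ h₁ hopt hf hidx'

/-! ## §4 Consequences: the residual of C2 is E-an-152e (the Frey-type habitat) modulo printed facts -/

/-- **E-an-152c ⟸ F★ ∧ CES ∧ E-an-152e** (the odd-squarefree index-`4` exclusion reduces to the Frey-type habitat).  CONDITIONAL; E-an-152e OPEN.
[cite: ConradEdixhovenStein2003, §6.1.2 and §6.2] [cite: Stevens1989, §2] -/
theorem shimuraIndexNeFourAtFourOddSquarefree_of_cuspRational_CES_freyHabitat (hF : optimalGamma1Parametrization_cusp_rational)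
    (hCES : exists_optimal_gamma1ParametrizationData) (he : CDivisionNeron.ShimuraIndexNeFourAtFourFreyHabitat) :
    CDivisionNeron.ShimuraIndexNeFourAtFourOddSquarefree :=
  CDivisionNeron.shimuraIndexNeFourAtFourOddSquarefree_of_fullTwoTorsion_of_freyHabitat
    (indexFourForcesFullRationalTwoTorsion_of_cuspRational_CES hF hCES) he

/-- **C2 `ManinOddAtFour` (stmt-BirchSwinnertonDyer-22967) ⟸ CDT THEOREM 1 ∧ F★ ∧ CES ∧ E-an-152e.**  Three PRINTED statement-only facts
(Calegari–Dimitrov–Tang Thm. 1.0.1 with rational-integer coefficients; Conrad–Edixhoven–Stein's cusp rationality and the existence of the optimal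
`X₁(N)`-datum) and ONE open arithmetic row: index-`4` exclusion for lattice-optimal data of Frey-type curves (full rational `2`-torsion) at
`N = 2^a·m`, `m` odd squarefree.  CONDITIONAL; C2, Manin's conjecture and BSD are not proved by this.
[cite: CalegariDimitrovTang2025, Thm. 1.0.1] [cite: ConradEdixhovenStein2003, §6.1.2, §6.2 and Lemma 6.1.6] [cite: Stevens1989, §2] -/
theorem maninOddAtFour_of_CDTInt_cuspRational_CES_freyHabitat (hCDT : CalegariDimitrovTang2025_unboundedDenominators)
    (hF : optimalGamma1Parametrization_cusp_rational) (hCES : exists_optimal_gamma1ParametrizationData)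
    (he : CDivisionNeron.ShimuraIndexNeFourAtFourFreyHabitat) :
    Summit.BirchSwinnertonDyer.BirchSwinnertonDyer.Theses.ManinLocalTwoThree.ManinOddAtFour :=
  CDivisionInt.maninOddAtFour_of_CDTInt_freyHabitat hCDT (indexFourForcesFullRationalTwoTorsion_of_cuspRational_CES hF hCES) he

/-- **THE WHOLE ROUTE: `ManinConstantOne` ⟸ PrintedSemistableManinFacts ∧ CDT Theorem 1 ∧ F★ ∧ CES ∧ E-an-152e** (through the route's `closes`, via
`CDivisionInt.maninConstantOne_of_printedFacts_CDTInt_indexNeFourOddSquarefree`).  CONDITIONAL architecture: four printed statement-only inputs and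
ONE open row (E-an-152e).  MANIN'S CONJECTURE AND BSD ARE NOT PROVED BY THIS. [cite: CalegariDimitrovTang2025, Thm. 1.0.1]
[cite: ConradEdixhovenStein2003, §6.1.2, §6.2 and Lemma 6.1.6] [cite: Cesnavicius2018, Thm. 1.2] [cite: Stevens1989, §2] -/
theorem maninConstantOne_of_printedFacts_CDTInt_cuspRational_CES_freyHabitat
    (hPF : Summit.BirchSwinnertonDyer.BirchSwinnertonDyer.Theses.ManinLocalTwoThree.PrintedSemistableManinFacts)
    (hCDT : CalegariDimitrovTang2025_unboundedDenominators) (hF : optimalGamma1Parametrization_cusp_rational)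
    (hCES : exists_optimal_gamma1ParametrizationData) (he : CDivisionNeron.ShimuraIndexNeFourAtFourFreyHabitat) :
    Summit.BirchSwinnertonDyer.Rank1Residual.ManinConstant.ManinConstantOne :=
  CDivisionInt.maninConstantOne_of_printedFacts_CDTInt_indexNeFourOddSquarefree hPF hCDT
    (shimuraIndexNeFourAtFourOddSquarefree_of_cuspRational_CES_freyHabitat hF hCES he)

end Summit.BirchSwinnertonDyer.BirchSwinnertonDyer.Theorems.ManinLocalTwoThree.IndexFourTwoTorsion

end
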